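import Summits.Ventures.Crystal3D.TopCut.T13c2593Agg1
import Summits.Ventures.PackingBounds.ThreePointCert.CheckDim3

/-!
# T13(arccos(2593/5000)): A(3, 2593/5000) ≤ 12: kernel validation of the blocks of (i') and of the `FI` expansion (part 2)

HONEST FRAMING: generated data / kernel-validation file of the venture `Crystal3D` (cell `pub-crystal3d`,
phase 2, seat p2): one piece of the kernel replay of an EXACT Bachoc–Vallentin three-point certificate on `S²`
(n = 3, s = 2593/5000, degree d = 8, Bachoc–Vallentin multiplier set) proving `A(3, s) ≤ 12` — the
"SDP top cut" `T13(arccos s)` of the sticky-sphere programme (no 13 unit vectors of `ℝ³` pairwise `≥ arccos s` apart).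
Source certificate: `cert_d8N8_c2593over5000_j175130.json` (pub-crystal3d phase2/sdp-topcut, p2 g6: CLARABEL float solve → rational
rounding → exact verification ×2, verify_bv + theory-2 verify2), converted by `cert2lean_p2.py` (an input adapter of
pub-packcert-sdp `cert2lean_s2.py`) into the integer units of the EXISTING tree checker of the venture `PackingBounds`
(cell `pub-packcert`): `ThreePointCert.Check` + `CheckDim3` + `CheckSym2` (soundness `SoundDim3.card_le_of_cert33S2`),
Gram factors offset-encoded for the Kronecker-packed chunk validation `ThreePointCert.CheckKron`; file layout of their
emitter `emitleanS2.py` (Leaf / Agg / Expand / Proof). Nothing geometric is proved in this file; plain lists of integers /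
monomials and `decide +kernel` facts about them (standard axioms only, no `native_decide`).
-/

namespace Summit.Ventures.Crystal3D.TopCut.T13c2593

open Literature.Geometry.DiscreteGeometry Literature.Geometry.DiscreteGeometry.PolyCert PolyCert.SPoly
open Summit.Ventures.PackingBounds.ThreePointCert

set_option maxRecDepth 100000 in
set_option maxHeartbeats 0 in
/-- `FI` expansion on `S²` (Chebyshev kernels `QI3`), blocks [2] (kernel, trie residual). -/
theorem okF_3 : FchunkOK3 T13c2593.cert.d [FBlk.mk 2 T13c2593.fw2] T13c2593.dFc2 T13c2593.dFc3 = true := by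
  decide +kernel

set_option maxRecDepth 100000 in
set_option maxHeartbeats 0 in
/-- `FI` expansion on `S²` (Chebyshev kernels `QI3`), blocks [3] (kernel, trie residual). -/
theorem okF_4 : FchunkOK3 T13c2593.cert.d [FBlk.mk 3 T13c2593.fw3] T13c2593.dFc3 T13c2593.dFc4 = true := by
  decide +kernel

set_option maxRecDepth 100000 in
set_option maxHeartbeats 0 in
/-- `FI` expansion on `S²` (Chebyshev kernels `QI3`), blocks [4] (kernel, trie residual). -/
theorem okF_5 : FchunkOK3 T13c2593.cert.d [FBlk.mk 4 T13c2593.fw4] T13c2593.dFc4 T13c2593.dFc5 = true := by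
  decide +kernel

set_option maxRecDepth 100000 in
set_option maxHeartbeats 0 in
/-- `FI` expansion on `S²` (Chebyshev kernels `QI3`), blocks [5] (kernel, trie residual). -/
theorem okF_6 : FchunkOK3 T13c2593.cert.d [FBlk.mk 5 T13c2593.fw5] T13c2593.dFc5 T13c2593.dFc6 = true := by
  decide +kernel

end Summit.Ventures.Crystal3D.TopCut.T13c2593
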